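import Literature.NumberTheory.LFunctions.NymanBeurlingRateEngine
import Literature.NumberTheory.LFunctions.NymanBeurling
import Literature.NumberTheory.LFunctions.NymanBeurlingRateReduction
import Literature.Barriers.RiemannHypothesis.NymanBeurlingObstructions
import HarnessLib

/-!
# Splittings / NB — the Balazard–de Roton RH-rate tail: a KERNEL RH-equivalent scheme, costume per instance

Cell rh-split, seat rh-split-nb-neg g5 (card `SPLIT-nb-neg.md` §11; census row V25).

The one tail family of the Nyman–Beurling circle whose RH-SIDE direction is a THEOREM: Balazard–de Roton
2010, Théorème 1 — under RH, `d_N² ≪_δ (log log N)^{5/2+δ}(log N)^{-1/2}` — is PROVED in the tree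
(`Literature.NumberTheory.LFunctions.BalazardDeRoton2010_thm1_holds`, via Soundararajan 2009 Prop. 1,
`SoundTest.prop1With_of_RH`), for Báez-Duarte's squared distance
`baezDuarteDistSqOf N c = ‖χ − Σ_{k<N} c_k {1/((k+1)x)}‖²_{L²(0,∞)}` (real coefficients).  With

  `TailBdR(C,δ,H) :≡ ∀ N ≥ H, ∃ c, baezDuarteDistSqOf N c ≤ C (log log N)^{5/2+δ} (log N)^{-1/2}`,

this file types:
* `natError_sq_eq_baezDuarteDistSqOf` — the bridge `‖χ − f‖²_{L²(0,∞)}` (the `eLpNorm` of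
  `Literature.NumberTheory.LFunctions.baezDuarte_iff` / `Literature.Barriers.RiemannHypothesis.natError`)
  `= baezDuarteDistSqOf` (the lintegral of the square);
* `rh_of_bdDistTail` — ANY tail `∀ N ≥ H, ∃ c, d_N²(c) ≤ g(N)` with `g → 0` gives RH (the elementary
  half of Báez-Duarte's criterion, tree `riemannHypothesis_of_beurling_closure`): the finite prefix
  `N < H` is invisible;
* (`C (log log N)^a (log N)^{-1/2} → 0` is the tree's `BalazardDeRoton.tendsto_loglog_rpow_mul_log_rpow`);
* `rh_of_bdRateTail` — **every instance `TailBdR(C,δ,H)` implies RH on its own** (costume: in a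
  splitting `FIN(H) ∧ TailBdR(C,δ,H) ⟹ RH` the finite conjunct is decoration);
* `rh_iff_bdRateTail_scheme` — **KERNEL RH-EQUIVALENT SCHEME: `RH ⟺ ∀ δ > 0, ∃ C H, TailBdR(C,δ,H)`**,
  both directions proved (→ : Balazard–de Roton; ← : Báez-Duarte), `(C,H)` FREE per `δ` (the printed
  `≪_δ` is ineffective, so no single instance is known to follow from RH).

SPLITTING READING (lens neg): V25 is the honest face of the NB costume theorem — a tail that is TRUE
under RH (for some C) and still leaves FIN(H) nothing to carry.  No definitions; std axioms expected
(the BdR proof tree is sorry-free in `Literature`).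

References: M. Balazard, A. de Roton, Int. J. Number Theory 6 (2010) 883–903 = arXiv:0812.1689, Thm 1
[corpus:paper:arxiv-0812.1689 p.2]; L. Báez-Duarte, Rend. Lincei 14 (2003) 5–11, Thm 1.1;
K. Soundararajan, arXiv:0810.3587 (Prop. 1).

HONEST LABEL: «SPLITTING SEARCH over kernel-typed RH-EQUIVALENCES; a splitting A ∧ B ⟹ RH is
CONDITIONAL bookkeeping unless A and B are both proved; nothing here bears on the truth of RH.»
-/

noncomputable section

-- D-0017: `Summit.<S>.<S>.…` is the designed namespace of a single-problem summit.
set_option linter.dupNamespace false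

open MeasureTheory Set Filter Topology Asymptotics
open scoped ENNReal

namespace Summit.RiemannHypothesis.RiemannHypothesis.Theorems.Splittings.NbBalazardDeRotonTail

open Literature.NumberTheory.LFunctions Literature.Barriers.RiemannHypothesis

/-- **Bridge.** `natError N c ^ 2 = baezDuarteDistSqOf N c`: the `L²((0,∞))` error of the natural
combination (an `eLpNorm`, as in `baezDuarte_iff`) squared is Báez-Duarte's squared distance (the
lintegral of the square). [folklore] -/
theorem natError_sq_eq_baezDuarteDistSqOf (N : ℕ) (c : Fin N → ℝ) :
    natError N c ^ 2 = baezDuarteDistSqOf N c := by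
  rw [natError_eq, baezDuarteDistSqOf_eq, eLpNorm_eq_lintegral_rpow_enorm_toReal (by norm_num) (by norm_num),
    ENNReal.toReal_ofNat, ← ENNReal.rpow_two, ← ENNReal.rpow_mul]
  norm_num
  refine lintegral_congr fun x ↦ ?_
  rw [Real.enorm_eq_ofReal_abs, ← ENNReal.ofReal_pow (abs_nonneg _), sq_abs]

/-- From a squared-distance bound below `ε²` to the `eLpNorm` bound below `ε`. [folklore] -/
theorem natError_lt_of_distSq_lt {N : ℕ} {c : Fin N → ℝ} {ε : ℝ} (hε : 0 < ε)
    (h : baezDuarteDistSqOf N c < ENNReal.ofReal (ε ^ 2)) : natError N c < ENNReal.ofReal ε := by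
  have h2 : natError N c ^ 2 < ENNReal.ofReal ε ^ 2 := by
    rwa [natError_sq_eq_baezDuarteDistSqOf, ← ENNReal.ofReal_pow hε.le]
  exact (ENNReal.pow_lt_pow_left_iff two_ne_zero).1 h2

/-- **Any vanishing tail of Báez-Duarte distances gives RH** (elementary half of the Nyman–Beurling–
Báez-Duarte criterion, tree `riemannHypothesis_of_beurling_closure`): if `d_N²(c_N) ≤ g(N)` for all
`N ≥ H` with `g → 0`, then RH — the prefix `N < H` is invisible. [cite: BaezDuarte2003, Thm. 1.1 ("if" part)] -/
theorem rh_of_bdDistTail {g : ℕ → ℝ} (hg : Tendsto g atTop (𝓝 0)) {H : ℕ}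
    (h : ∀ N : ℕ, H ≤ N → ∃ c : Fin N → ℝ, baezDuarteDistSqOf N c ≤ ENNReal.ofReal (g N)) :
    RiemannHypothesis := by
  refine riemannHypothesis_of_beurling_closure fun ε hε ↦ ?_
  have hev : ∀ᶠ N : ℕ in atTop, g N < ε ^ 2 := hg.eventually (gt_mem_nhds (by positivity))
  obtain ⟨N, hN, hNH⟩ := (hev.and (eventually_ge_atTop H)).exists
  obtain ⟨c, hc⟩ := h N hNH
  refine ⟨N, c, ?_⟩
  rw [← natError_eq]
  exact natError_lt_of_distSq_lt hε (hc.trans_lt ((ENNReal.ofReal_lt_ofReal_iff (by positivity)).2 hN))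

-- The Balazard–de Roton rate `C (log log N)^a (log N)^{-1/2} → 0` is the landed
-- `Literature.NumberTheory.LFunctions.BalazardDeRoton.tendsto_loglog_rpow_mul_log_rpow` (not restated — dedup).

/-- **nb/neg g5 (V25): every instance of the Balazard–de Roton tail implies RH on its own** — so in
`FIN(H) ∧ TailBdR(C,δ,H) ⟹ RH` the finite conjunct is decoration (costume).
[cite: BalazardDeRoton2010, Théorème 1] [cite: BaezDuarte2003, Thm. 1.1] -/
theorem rh_of_bdRateTail {C δ : ℝ} {H : ℕ}
    (h : ∀ N : ℕ, H ≤ N → ∃ c : Fin N → ℝ, baezDuarteDistSqOf N c ≤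
      ENNReal.ofReal (C * Real.log (Real.log (N : ℝ)) ^ (5 / 2 + δ) * Real.log (N : ℝ) ^ (-(1 / 2 : ℝ)))) :
    RiemannHypothesis :=
  rh_of_bdDistTail (BalazardDeRoton.tendsto_loglog_rpow_mul_log_rpow C (5 / 2 + δ)) h

/-- **nb/neg g5 (V25): KERNEL RH-EQUIVALENT SCHEME.** `RH ⟺ ∀ δ > 0, ∃ C H, ∀ N ≥ H, ∃ c,
d_N²(c) ≤ C (log log N)^{5/2+δ} (log N)^{-1/2}` — (→) Balazard–de Roton 2010 Thm 1, PROVED in the tree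
(`BalazardDeRoton2010_thm1_holds`, `H = 3`); (←) Báez-Duarte.  `(C,H)` are free per `δ`: no
single instance is known to follow from RH (the printed `≪_δ` is ineffective).
[cite: BalazardDeRoton2010, Théorème 1] [cite: BaezDuarte2003, Thm. 1.1] -/
theorem rh_iff_bdRateTail_scheme :
    RiemannHypothesis ↔ ∀ δ : ℝ, 0 < δ → ∃ C : ℝ, ∃ H : ℕ, ∀ N : ℕ, H ≤ N → ∃ c : Fin N → ℝ,
      baezDuarteDistSqOf N c ≤
        ENNReal.ofReal (C * Real.log (Real.log (N : ℝ)) ^ (5 / 2 + δ) * Real.log (N : ℝ) ^ (-(1 / 2 : ℝ))) := by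
  constructor
  · intro hRH δ hδ
    obtain ⟨C, hC⟩ := BalazardDeRoton2010_thm1_holds hRH δ hδ
    exact ⟨C, 3, fun N hN ↦ hC N hN⟩
  · intro h
    obtain ⟨C, H, hC⟩ := h 1 one_pos
    exact rh_of_bdRateTail hC

end Summit.RiemannHypothesis.RiemannHypothesis.Theorems.Splittings.NbBalazardDeRotonTail

end
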